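import Literature.AlgebraicGeometry.Hironaka2017.S04CharAlgebra.R003PAlgebra
import Mathlib.RingTheory.Ideal.Colon
import HarnessLib

/-!
# [OURS · L1 W1.4 — kill-test-only slot, reading (A)] Elimination algebra instead of negative modules:
# the ring-level carrier «`℘(Ě) ∩ S[W]`», its graded pieces, the chart-level weak transform, and the
# transformation-law schema (writer res-L1-type-o2, OURS typer o2, group G1)

LADDER-RESOLUTION rung L (rescue), cell `res-hironaka`, plan/RESCUE-SEED.md v0.5 §1 row **W1.4** «ELIMINATION ALGEBRA
INSTEAD OF NEGATIVE MODULES» — slot proposed by res-plan-2, ADOPTED KILL-TEST-ONLY by director-resolution 2026-08-27T00:42:40Z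
(«file only what K1.4's pre-registration names»), reading (A) «upper envelope» fixed by director-resolution 01:05:24Z (2) /
01:09:10Z. HISTORY OF THIS FILE: written 2026-08-27T00:36Z as the typer's RESERVE (sha16 35056bb601d37c4f, farm-clean, unfiled);
NAMED as the object of kill test K1.4 by res-L1-k14's PRE-REGISTRATION 01:51:55Z («DECLS NEEDED FILED: the reserve draft AS IS,
one file, 18 decls; `ElimOrderAt` NOT requested»; text of record `L/res-L1-k14/PREREG-K1.4.md` 9d2e7caa508665d9) and again by its
verdict line KILL-TEST K1.4 ALIVE(A) 02:19:59Z («an R04-LAW SUPPLIER EXISTS, nothing more»; kit j265389; kernel witnesses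
`MarkedTransferCampaignW14K14ElimWitnesses.lean` p486835, written against row 003 + Mathlib and NOT importing this file; report
`L/res-L1-k14/KILL-TEST-K1.4.md` 292d1c786d770199); FILED now with the Lean terms UNCHANGED from 35056bb601d37c4f (this header
paragraph is the only edit). The objects below are what K1.4 quantified over, typed at RING / CHART level over the tree's
vocabulary. K1.4's scores for the record (its report §5, not claims of this file): ℘nega-INTERFACE F6/F7 N/A-AS-TYPED (no negative
degrees here), F1 ✓ in print + ✓ WITH EQUALITY on witness W1's first transform in both charts (kernel-general half OPEN = the schema
`CampaignW14.ElimTransformLawChart` below), F2 ✓, F3 relative ✓ / absolute N/A; located ceiling = the monomial case. Host as for the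
other G1 OURS files: `--supports stmt-ResolutionOfSingularities-15522` (MarkedTransfer `HypersurfaceToMarked`), namespace
`…Theorems.Campaign`. A §5 «orders» sibling (`ReesOrdGe/ElimOrdGe/…`, reserve 1b8e4d2921fa1d35) exists UNFILED and stays so
unless a seat names it.

HONEST FRAMING. Nothing here is a statement of H. Hironaka's manuscript *Resolution of singularities in positive
characteristics* (2017-03-23, [Hironaka2017], lit key `paper:url-3343fd9e678b`): its `℘(E)` (p.17 L8–L11, typed row 003
`S04CharAlgebra.pAlgebraicRing`, ALGEBRAIC definition U17_2) enters only as the typed carrier, a CANDIDATE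
[claim: Hironaka2017, status: under-review]. Nothing here is a statement of O. Villamayor's / A. Bravo–O. Villamayor's
papers either: their elimination algebra `R_{G,β}` (Villamayor, *Hypersurface singularities in positive
characteristic*, Adv. Math. 2007 = corpus `paper:arxiv-math_0606796`, Def 1.42 p.14 L18–L38 (universal → concrete),
Def 4.10 p.22 L46–L60; Bravo–Villamayor, *Singularities in positive characteristic, stratification and simplification
of the singular locus*, Adv. Math. 224 (2010) = corpus `paper:arxiv-0807.4308`, §2.7–§2.9 pp.24–25) is NOT constructed
here. What IS typed is the UPPER ENVELOPE `G ∩ S[W]` of `R_{G,β}` — the object the sources prove `R_{G,β}` sits in with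
the same integral closure (INSIDE: `R_G ⊂ S[W]` by V2007 Def 4.10 p.22 L46–L60 and `R_G ⊂ G_x` by Th 4.13 p.23
L83–L92, = BV2010 §2.7 (i) p.24 L109–L112; SAME INTEGRAL CLOSURE: `G ∩ S[W]` embeds in `Ḡ ∩ S[W]`, `Ḡ` the restriction to
`B = S[Z]/⟨f_{c₁}⟩`, which is integral over `R_G` by Th 4.11 (ii)–(iv) p.22 L99–L110, = BV2010 §2.9 p.25 L33–L48) — as an honest, integrally-coarser stand-in («reading (A)»); every
decl says so. OBSERVATION (typing level, checkable on the printed generator lists, no theorem of either source used):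
the typed ALGEBRAIC `℘(Ě)` of `Ě = (J, b)` is the integral closure in `O[X]` of the `O`-algebra generated by
`Diff^{(j)}(J)·X^{b−j}`, `0 ≤ j < b` (manuscript p.17 L8–L11) — generator for generator the Diff-algebra spanned by
`O[J W^b]` of V2007 Th 3.4 (display p.17 L91–L95: `Δ^α(g) W^{n′−|α|}`, `0 ≤ |α| < n′ ≤ b`), so W1.4 eliminates THE
SAME graded algebra whose negative part row L-G1 lost (K1.1/K1.2): no new «positive» carrier is needed, only the
projection side `S → O` and the elimination. AI typing, weaker than expert review; nothing here is progress on
resolution of singularities in positive characteristic; no claim beyond the kernel.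

CONTENTS (all sorry-free; `[folklore]` = definitions / unfoldings / pure commutative algebra):
§1 `Campaign.elimUpper S A` — for an `S`-algebra `O` and a subalgebra `A ⊆ O[X]`: `{q ∈ S[X] | q ↦ A}` («`A ∩ S[W]`»),
   `mem_elimUpper_iff`, `elimPiece` (degree pieces `J_k`, V2007 Def 4.10 «`R_G = ⊕ J_k W^k`»), `mem_elimPiece_iff`,
   `elimPiece_eq_comap`, `isGradedSubalgebra_elimUpper`, `elimUpper_mono`, `elimUpper_top` (vacuity marker).
§2 `Campaign.elimAlgUpper S K O J b` := `elimUpper S (pAlgebraicRing K O J b)` — THE W1.4 OBJECT (reading (A)) for an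
   ideal exponent `Ě = (J, b)` on a `K`-algebra `O` that is also an `S`-algebra (`S = O_{Z₁,β(ξ)}`, `β : Z → Z₁` the
   transversal projection of RESCUE-SEED W1.4; transversality / `β`-admissibility are NOT part of the definition —
   they are hypotheses of whatever is claimed about it); pieces `elimAlgPiece`, `mem_elimAlgPiece_iff`.
§3 `Campaign.weakPiece σ u I n` := `(I_n O₁ : u^n)` — V2007 Def 6.1 p.29 L3–L13 «`I_n O_{V₁} = I_n^{(1)}·I(H)^n`» in ONE
   chart `σ : O → O₁` with `u` a local equation of the exceptional hypersurface `H`, colon reading (equal to the printed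
   factor when `u` is a non-zero-divisor and `I_n O₁ ⊆ (u^n)`, i.e. under permissibility — hypotheses, not baked in);
   `mem_weakPiece_iff`.
§4 the LAW, chart level, reading (A): `Campaign.weakPiece_elim_le` — the cheap half «`(R_G)₁ ⊆ G₁ ∩ S₁[W]`» degree-wise,
   PROVED for compatible charts (pure algebra); `CampaignW14.ElimTransformLawChart` — the other half «`G₁ ∩ S₁[W]` is
   integral over the transform of `G ∩ S[W]`» = the content of BV2010 Th 3.1 (ii)(b) p.26 L52–L59 («natural inclusion
   … which is an equality up to integral closure») transported to reading (A): a `Prop` SCHEMA with every datum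
   explicit, STATED NOT CLAIMED (K1.4 (ii) decides it on W1's first transform); `CampaignW14.ElimProperAt` — K1.4 (i)'s
   «proper in degree `k` at the point» as a one-line `Prop`.
-/

noncomputable section

set_option linter.dupNamespace false -- mandated namespace of this single-conjunct summit

open Polynomial

namespace Summit.ResolutionOfSingularities.ResolutionOfSingularities.Theorems.Campaign

open Literature.AlgebraicGeometry.Hironaka2017
open Literature.AlgebraicGeometry.Hironaka2017.S04CharAlgebra (IsGradedSubalgebra homogPiece pAlgebraicRing
  familySubalgebra)

universe u

/-! ## §1 Elimination by intersection: `A ∩ S[W]` for a subalgebra `A ⊆ O[X]` over an `S`-algebra `O` -/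

section Generic

variable (S : Type u) [CommRing S] {O : Type u} [CommRing O] [Algebra S O]

/-- [OURS · L1 W1.4, reading (A) «upper envelope»] For an `S`-algebra `O` (the projection side `β^* : O_{Z₁} → O_Z`)
and a subalgebra `A ⊆ O[X] = Bl∗` (a Rees algebra `⊕ I_k W^k` in Villamayor's sense, V2007 Def 3.3 p.17 L45–L52), the
`S`-subalgebra `{q ∈ S[X] | β^*(q) ∈ A}` of `S[X]` — «`A ∩ S[W]`», the algebra V2007 Def 4.10 p.22 L46–L60 / Th 4.13 p.23
L83–L92 and BV2010 §2.7 (i) p.24 L109–L112 place the elimination algebra `R_{A,β}` INSIDE, with the same integral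
closure (via the restriction `Ā ∩ S[W]`, Th 4.11 (ii)–(iv) p.22 L99–L110; BV2010 §2.9 p.25 L33–L48). Replaces the role of `R_{G,β}` (V2007 Def 4.10 p.22 L46–L60)
as its integrally-coarser stand-in; NOT Villamayor's construction (Def 1.42 p.14, universal invariants) and NOT a
statement of either source. VACUITY: a term; `elimUpper S ⊤ = ⊤` (`elimUpper_top`), and for `A` trivial in positive
degrees so is `elimUpper S A`. [folklore] -/
def elimUpper (A : Subalgebra O O[X]) : Subalgebra S S[X] where
  carrier := {q | q.map (algebraMap S O) ∈ A}
  mul_mem' {a b} ha hb := by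
    simp only [Set.mem_setOf_eq, Polynomial.map_mul] at *
    exact A.mul_mem ha hb
  one_mem' := by simp only [Set.mem_setOf_eq, Polynomial.map_one]; exact A.one_mem
  add_mem' {a b} ha hb := by
    simp only [Set.mem_setOf_eq, Polynomial.map_add] at *
    exact A.add_mem ha hb
  zero_mem' := by simp only [Set.mem_setOf_eq, Polynomial.map_zero]; exact A.zero_mem
  algebraMap_mem' s := by
    have h := A.algebraMap_mem (algebraMap S O s)
    rw [Polynomial.algebraMap_eq] at h
    simpa only [Set.mem_setOf_eq, Polynomial.algebraMap_eq, Polynomial.map_C] using h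

/-- Unfolding (by `Iff.rfl`): `q ∈ A ∩ S[W]` iff its image in `O[X]` lies in `A`. [folklore] -/
theorem mem_elimUpper_iff (A : Subalgebra O O[X]) (q : S[X]) :
    q ∈ elimUpper S A ↔ q.map (algebraMap S O) ∈ A :=
  Iff.rfl

/-- [OURS · L1 W1.4, reading (A)] the degree-`k` piece `J_k ⊆ S` of `A ∩ S[W]` (V2007 Def 4.10 p.22 L55–L60 «as graded
subalgebra, `R_G = ⊕ J_k·W^k` for suitable ideals `J_k` in `S`», here for the envelope): row 003's `homogPiece` of
`elimUpper S A`. VACUITY: a term. [folklore] -/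
def elimPiece (A : Subalgebra O O[X]) (k : ℕ) : Ideal S :=
  homogPiece S (elimUpper S A) k

/-- Unfolding: `c ∈ J_k` iff `β^*(c)·X^k ∈ A`, i.e. iff `β^*(c)` lies in the degree-`k` piece of `A`. [folklore] -/
theorem mem_elimPiece_iff (A : Subalgebra O O[X]) (k : ℕ) (c : S) :
    c ∈ elimPiece S A k ↔ algebraMap S O c ∈ homogPiece O A k := by
  simp only [elimPiece, homogPiece, Submodule.mem_comap, Subalgebra.mem_toSubmodule, mem_elimUpper_iff,
    Polynomial.map_monomial]

/-- The degree pieces of the envelope are the contractions `J_k = A_k ∩ S` of the degree pieces of `A`. [folklore] -/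
theorem elimPiece_eq_comap (A : Subalgebra O O[X]) (k : ℕ) :
    elimPiece S A k = (homogPiece O A k).comap (algebraMap S O) := by
  ext c
  exact mem_elimPiece_iff S A k c

/-- The envelope of a GRADED subalgebra (row 003 `IsGradedSubalgebra`, Th 4.1 p.17 L20–L22 shape) is graded. [folklore] -/
theorem isGradedSubalgebra_elimUpper {A : Subalgebra O O[X]} (hA : IsGradedSubalgebra O A) :
    IsGradedSubalgebra S (elimUpper S A) := by
  intro g hg a
  rw [mem_elimUpper_iff, Polynomial.map_monomial, ← Polynomial.coeff_map]
  exact hA _ hg a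

/-- Monotonicity of the envelope in `A`. [folklore] -/
theorem elimUpper_mono {A B : Subalgebra O O[X]} (h : A ≤ B) : elimUpper S A ≤ elimUpper S B :=
  fun _ hq => h hq

/-- VACUITY marker: the envelope of everything is everything. [folklore] -/
theorem elimUpper_top : elimUpper S (⊤ : Subalgebra O O[X]) = ⊤ :=
  top_unique fun _ _ => Algebra.mem_top

end Generic

/-! ## §2 The W1.4 object for an ideal exponent `Ě = (J, b)`: `℘(Ě) ∩ S[W]` (reading (A)) -/

section IdealExponent

variable (S : Type u) [CommRing S] (K : Type u) [CommRing K] {O : Type u} [CommRing O] [Algebra K O] [Algebra S O]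

/-- [OURS · L1 W1.4] replaces the role — for RESCUE-SEED v0.5 §1 row W1.4 («the ELIMINATION ALGEBRA of (the Rees algebra
of) `Ê` under a transversal generic projection `β : Z → Z₁`, … the G1 content read on `Z₁`») — of Villamayor's
`R_{G,β} ⊂ O_{V′}[W]` (V2007 Def 4.10 p.22; BV2010 §2.7 p.24) at `G :=` the typed ALGEBRAIC `℘(Ě)` of `Ě = (J, b)` (row
003 `S04CharAlgebra.pAlgebraicRing K O J b`, manuscript p.17 L8–L11 = the integral closure of V2007 Th 3.4's Diff-algebra
of the pair, same generators), in reading (A): the envelope `℘(Ě) ∩ S[X] ⊆ S[X]`, `S = O_{Z₁,β(ξ)}` acting on `O = O_{Z,ξ}`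
through `β^*`. `K` (base field of the absolute `Diff`) and `S` are independent parameters; transversality and
`β`-admissibility (BV2010 Def 8.3 / §2.7) are NOT encoded — hypotheses of any claim, not of the object. NOT a statement
of the manuscript or of V2007/BV2010. VACUITY: a term; its degree-`0` piece is all of `S` as soon as `℘(Ě,0) = O`
(candidate Th 4.1), and the positive pieces at a point of order `≥ b` lie in the maximal ideal — «proper» is therefore
NOT the informative question in positive degree (see `CampaignW14.ElimProperAt`). [folklore] -/
def elimAlgUpper (J : Ideal O) (b : ℕ) : Subalgebra S S[X] :=
  elimUpper S (pAlgebraicRing K O J b)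

/-- [OURS · L1 W1.4] the degree-`k` elimination ideal `J_k(Ě, β) ⊆ S` of `℘(Ě) ∩ S[W]` (reading (A)). [folklore] -/
def elimAlgPiece (J : Ideal O) (b k : ℕ) : Ideal S :=
  elimPiece S (pAlgebraicRing K O J b) k

/-- Unfolding: `c ∈ J_k(Ě, β)` iff `β^*(c)·X^k ∈ ℘(Ě)` (iff `β^*(c) ∈ ℘(Ě, k)` = row 003 `homogPiece`; = the W1.3 file's
`Campaign.pAlgPiece K J b k`, same term, not imported here). [folklore] -/
theorem mem_elimAlgPiece_iff (J : Ideal O) (b k : ℕ) (c : S) :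
    c ∈ elimAlgPiece S K J b k ↔ monomial k (algebraMap S O c) ∈ pAlgebraicRing K O J b := by
  rw [elimAlgPiece, mem_elimPiece_iff]
  rfl

/-- The elimination ideals are contractions of the `℘`-pieces: `J_k(Ě, β) = ℘(Ě, k) ∩ S`. [folklore] -/
theorem elimAlgPiece_eq_comap (J : Ideal O) (b k : ℕ) :
    elimAlgPiece S K J b k = (homogPiece O (pAlgebraicRing K O J b) k).comap (algebraMap S O) :=
  elimPiece_eq_comap S _ k

end IdealExponent

/-! ## §3 Weak (weighted) transform of a graded family in ONE chart of a blow-up -/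

section WeakTransform

variable {O O₁ : Type u} [CommRing O] [CommRing O₁]

/-- [OURS · L1 W1.4] replaces the role — in ONE affine chart `σ : O → O₁` of a blow-up with `u ∈ O₁` a local equation of
the exceptional hypersurface `H` — of V2007 Def 6.1 p.29 L3–L13 «`I_n O_{V₁} = I_n^{(1)}·I(H)^n` … the weighted transform
of `I_n`» (BV2010 §3.2 «weak transforms»): the colon reading `I_n^{(1)} := (I_n O₁ : u^n)` (Mathlib `Submodule.colon` against the singleton `{u^n}`). It EQUALS the printed factor
when `u` is a non-zero-divisor and `I_n O₁ ⊆ (u^n)` (permissible centre, V2007 Def 6.1 p.29 L5–L11); neither is assumed by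
the term. Same shape as the tree's scheme-level `Resolution.controlledTransform` (row 001 rendering) restricted to a
chart; kept ring-level because K1.4 computes in charts. VACUITY: a term; at `u` a unit it is `I_n O₁`. [folklore] -/
def weakPiece (σ : O →+* O₁) (u : O₁) (I : ℕ → Ideal O) (n : ℕ) : Ideal O₁ :=
  ((I n).map σ).colon {u ^ n}

/-- Unfolding: `c ∈ I_n^{(1)}` iff `c·u^n ∈ I_n O₁`. [folklore] -/
theorem mem_weakPiece_iff (σ : O →+* O₁) (u : O₁) (I : ℕ → Ideal O) (n : ℕ) (c : O₁) :
    c ∈ weakPiece σ u I n ↔ c * u ^ n ∈ (I n).map σ := by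
  rw [weakPiece, Submodule.mem_colon_singleton, smul_eq_mul]

end WeakTransform

/-! ## §4 The transformation law in a chart (reading (A)) and the K1.4 (i) predicate -/

section Law

variable {S S₁ O O₁ : Type u} [CommRing S] [CommRing S₁] [CommRing O] [CommRing O₁] [Algebra S O] [Algebra S₁ O₁]

/-- THE CHEAP HALF OF THE LAW, PROVED (pure algebra): for COMPATIBLE charts — `σ : O → O₁` over `σ′ : S → S₁`
(`σ ∘ β^* = β₁^* ∘ σ′`, BV2010 Th 3.1 (ii)'s commutative square p.26 L28–L44 in one chart) with the exceptional equation
`u′ ∈ S₁` of the lower blow-up mapping to the exceptional equation `u ∈ O₁` of the upper one — the weak transform of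
the envelope's pieces lies in the envelope of the weak transform, degree by degree: «`(A ∩ S[W])₁ ⊆ A₁ ∩ S₁[W]`». No
non-zero-divisor or permissibility hypothesis is needed for this direction. [folklore] -/
theorem weakPiece_elim_le (σ : O →+* O₁) (σ' : S →+* S₁)
    (hcomm : σ.comp (algebraMap S O) = (algebraMap S₁ O₁).comp σ') {u : O₁} {u' : S₁}
    (hu : algebraMap S₁ O₁ u' = u) (A : Subalgebra O O[X]) (k : ℕ) :
    weakPiece σ' u' (elimPiece S A) k ≤ (weakPiece σ u (homogPiece O A) k).comap (algebraMap S₁ O₁) := by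
  intro c hc
  rw [Ideal.mem_comap, mem_weakPiece_iff]
  rw [mem_weakPiece_iff] at hc
  have h1 : algebraMap S₁ O₁ (c * u' ^ k) ∈ ((elimPiece S A k).map σ').map (algebraMap S₁ O₁) :=
    Ideal.mem_map_of_mem _ hc
  rw [map_mul, map_pow, hu, Ideal.map_map, ← hcomm, ← Ideal.map_map] at h1
  refine Ideal.map_mono ?_ h1
  rw [elimPiece_eq_comap]
  exact Ideal.map_comap_le

end Law

end Summit.ResolutionOfSingularities.ResolutionOfSingularities.Theorems.Campaign

namespace Summit.ResolutionOfSingularities.ResolutionOfSingularities.Theorems.CampaignW14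

open Literature.AlgebraicGeometry.Hironaka2017.S04CharAlgebra (homogPiece pAlgebraicRing familySubalgebra)
open Summit.ResolutionOfSingularities.ResolutionOfSingularities.Theorems.Campaign

universe u

variable {S S₁ K O O₁ : Type u} [CommRing S] [CommRing S₁] [CommRing K] [CommRing O] [CommRing O₁]
  [Algebra S O] [Algebra S₁ O₁] [Algebra K O]

/-- [OURS · L1 W1.4] replaces the role — for the PROPOSED slot W1.4's kill test K1.4 (ii) («its BV transformation law
VERIFIES on W1's first transform at `ξ′`») — of Bravo–Villamayor 2010 Th 3.1 (ii)(b) p.26 L52–L59 («Locally in an open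
neighborhood of `x′₁`, there is a natural inclusion `G^{(d−1)′} ⊂ G′^{(d−1)}` which is an equality up to integral
closure»; V2007 §6.7 p.30 L67–L69 states the same «`R_{G₁} = (R_G)₁` … both algebras have the same integral closure …
This property is not addressed in this work»), TRANSPORTED to reading (A) and to ONE pair of compatible charts
(`σ : O → O₁` over `σ′ : S → S₁`, exceptional equations `u′ ↦ u`) at `G := ℘(Ě)` (row 003, algebraic): every element of
the envelope of the weak transform, `(℘(Ě))₁ ∩ S₁[W]` (pieces `(weakPiece σ u ℘(Ě,·) k) ∩ S₁`), is INTEGRAL over the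
`S₁`-algebra generated by the weak transform of the envelope, `((℘(Ě) ∩ S[W]))₁` (pieces `weakPiece σ′ u′ J_·(Ě,β)`).
Together with the proved cheap half `Campaign.weakPiece_elim_le` this is «equality up to integral closure» in the
chart. A `Prop` SCHEMA with every datum explicit — STATED, NOT CLAIMED; the sources prove their statement for
`R_{G,β}` itself under `β`-admissibility and permissibility (BV2010 Th 3.1 hypotheses p.26 L9–L23: `x` simple, `β` `G`-admissible, `Y ⊂ Sing G` permissible), which the
instantiating seat must supply or test; NOT a statement of the manuscript. VACUITY: at `u, u′` units both sides are
base changes and the Prop is the integrality of `℘(Ě)O₁ ∩ S₁[W]` over `(℘(Ě) ∩ S[W])S₁` — not automatic (that is the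
commutation of elimination with base change); not provable by `rfl`. [folklore] -/
def ElimTransformLawChart (σ : O →+* O₁) (σ' : S →+* S₁) (u : O₁) (u' : S₁) (J : Ideal O) (b : ℕ) : Prop :=
  ∀ (k : ℕ) (c : S₁), algebraMap S₁ O₁ c ∈ weakPiece σ u (homogPiece O (pAlgebraicRing K O J b)) k →
    IsIntegral (familySubalgebra S₁ (weakPiece σ' u' (elimAlgPiece S K J b))) (monomial k c : S₁[X])

/-- [OURS · L1 W1.4] replaces the role — for K1.4 (i) («PROPER in the relevant degree on all three witnesses (carries
order `≥ 1` information where `℘nega` collapsed)») — of the sentence «`J_k(Ě, β) ⊆ 𝔫`» at the point `β(ξ)` with maximal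
ideal `𝔫 ⊆ S`, degree `k`: the degree-`k` elimination ideal (reading (A)) is a proper ideal at the point. One line, so
that the kill test's ALIVE/DEAD rows name a decl. HONEST NOTE: at a point where `J` has order `≥ b`, `℘(Ě,k) ⊆ 𝔪_ξ^k`
makes this automatic for `k ≥ 1` whenever `𝔪_ξ ∩ S = 𝔫`; the informative K1.4 (i) question is which `k` carry elements
of `𝔫`-order EXACTLY `k·(ord/b)` (BV2010 Main Th 1.1 p.29: `ord R_{G,β}` is projection-independent) — an order
statement the k-seat phrases on the instance; this decl is only the carrier-level sentence. VACUITY: false at `k = 0`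
as soon as `℘(Ě,0) = O` (then `J_0 = S`). [folklore] -/
def ElimProperAt (𝔫 : Ideal S) (J : Ideal O) (b k : ℕ) : Prop :=
  elimAlgPiece S K J b k ≤ 𝔫

/-- Pure logic: properness in degree `k` is inherited from properness of `℘(Ě,k)` at any ideal of `O` contracting
into `𝔫`. [folklore] -/
theorem elimProperAt_of_piece_le {𝔫 : Ideal S} {𝔪 : Ideal O} (h𝔪 : 𝔪.comap (algebraMap S O) ≤ 𝔫) {J : Ideal O}
    {b k : ℕ} (hk : homogPiece O (pAlgebraicRing K O J b) k ≤ 𝔪) : ElimProperAt (S := S) (K := K) 𝔫 J b k := by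
  intro c hc
  rw [mem_elimAlgPiece_iff] at hc
  exact h𝔪 (Ideal.mem_comap.mpr (hk hc))

end Summit.ResolutionOfSingularities.ResolutionOfSingularities.Theorems.CampaignW14

end
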